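import Literature.NumberTheory.GaloisRepresentations.ConeCocycles
import Literature.NumberTheory.GaloisRepresentations.ConeCoefficients
import Literature.NumberTheory.GaloisRepresentations.MotherExtension
import Literature.NumberTheory.GaloisRepresentations.LiftingObstructionSections
import Literature.NumberTheory.GaloisRepresentations.DeformationLocalObstruction
import HarnessLib

/-!
# The cone cochain of a functional `u ∈ (J/𝔪J)^*` and the cone obstruction map

Topic `Literature/NumberTheory/GaloisRepresentations`.  For the universal nearly ordinary
deformation ring `R = R_𝒟`, a presentation `Θ : 𝒪⟦T₁,…,T_m⟧ ↠ R` with kernel `J`, an exponent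
`n ≥ 1` with `J ∩ 𝔪ⁿ ⊆ 𝔪J`, and the mother extension `q₀ : B₀ = 𝒪⟦T⟧/(𝔪J + 𝔪ⁿ) ↠ R/𝔪ⁿ`
(`MotherExtension.lean`) with its standard section `s₀`, we attach to every functional
`u ∈ (J/𝔪J)^*` the **cone cochain** (coefficients `κ = 𝒪⟦T⟧/𝔪`, values in `M₂(κ)`)

* global component `(σ, τ) ↦ Λ_u(c_{s₀}(ρ_𝒟 mod 𝔪ⁿ)(σ, τ))` on `G_{F,S}`,
* local components `(σ, τ) ↦ Λ_u(c_{s₀}(localModPow v n)(σ, τ))` (upper triangular) and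
  `σ ↦ Λ_u(β_v(σ))`, `β_v = sectionDiff s₀ s₀''` the comparison cochain of `s₀` with the framed
  section `s₀'' = P₀⁻¹ s₀(N · N⁻¹) P₀` (`P₀ = s₀(N)`, `N` the reduced nearly ordinary frame),
  for the finitely many `v ∣ p`,

prove that it is a cone cocycle (`coneCochainOf_mem`: continuity from the open kernels, the
cocycle identities from `liftDefect_cocycle`, the linking identities from
`liftDefect_frameSection` and `liftDefect_sub_liftDefect`, all pushed through the
kernel-semilinear functional `Λ_u`), that it is LINEAR in `u` (`coneCochainOf_add/_smul`), and
define the **cone obstruction map** `coneOb : (J/𝔪J)^* →ₗ[κ] ConeH2` (Böckle 2007, proof of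
Thm. 7.6 in the cone formulation; Mazur 1989, §1.6).  Everything is proved; no named facts.

## References

* G. Böckle, *Presentations of universal deformation rings*, LMS LNS 320 (2007), §5, Thm. 7.6.
  [cite: Bockle2007Presentations, Theorem 7.6]
* B. Mazur, *Deforming Galois representations*, MSRI Publ. 16 (1989), §1.6 Prop. 2.
  [cite: Mazur1989Deforming, §1.6 Prop. 2]
-/

noncomputable section

open scoped NumberField
open Field IsDedekindDomain IsLocalRing Topology

namespace Literature.NumberTheory.GaloisRepresentations

/-! ## 0. Entrywise images of kernel matrices under a kernel-semilinear functional -/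

namespace LiftingObstruction

section MapKernel

variable {ι : Type} [Fintype ι] [DecidableEq ι] {A B κ : Type} [CommRing A] [CommRing B]
  [CommRing κ] {φ : B →+* A} {res : B →+* κ} {Λ : B → κ}

/-- `Λ(X + Y) = Λ(X) + Λ(Y)` entrywise for kernel matrices. [folklore] -/
theorem map_add_of_mem_kerMatrix (hΛ : IsKernelSemilinear (φ := φ) res Λ) {X Y : Matrix ι ι B}
    (hX : X ∈ kerMatrix φ) (hY : Y ∈ kerMatrix φ) : (X + Y).map Λ = X.map Λ + Y.map Λ := by
  ext i j
  simp only [Matrix.map_apply, Matrix.add_apply]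
  exact hΛ.map_add _ _ ((RingHom.mem_ker).mpr ((mem_kerMatrix_iff _).mp hX i j))
    ((RingHom.mem_ker).mpr ((mem_kerMatrix_iff _).mp hY i j))

/-- `Λ(X - Y) = Λ(X) - Λ(Y)` entrywise for kernel matrices. [folklore] -/
theorem map_sub_of_mem_kerMatrix (hΛ : IsKernelSemilinear (φ := φ) res Λ) {X Y : Matrix ι ι B}
    (hX : X ∈ kerMatrix φ) (hY : Y ∈ kerMatrix φ) : (X - Y).map Λ = X.map Λ - Y.map Λ := by
  rw [eq_sub_iff_add_eq, ← map_add_of_mem_kerMatrix hΛ ((kerMatrix φ).sub_mem hX hY) hY,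
    sub_add_cancel]

/-- `Λ(g X g⁻¹) = r X r⁻¹` with `r = GL_n(res)(g)`, for a kernel matrix `X`. [folklore] -/
theorem map_conj_of_mem_kerMatrix (hΛ : IsKernelSemilinear (φ := φ) res Λ) (g : GL ι B)
    {X : Matrix ι ι B} (hX : X ∈ kerMatrix φ) :
    ((g : Matrix ι ι B) * X * ((g⁻¹ : GL ι B) : Matrix ι ι B)).map Λ =
      conjLin (Matrix.GeneralLinearGroup.map res g) (X.map Λ) := by
  rw [map_mul_mul_of_kernelSemilinear hΛ _ _ hX, conjLin_apply, ← map_inv]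
  rfl

/-- `Λ(g⁻¹ X g) = r⁻¹ X r` with `r = GL_n(res)(g)`, for a kernel matrix `X`. [folklore] -/
theorem map_conj_inv_of_mem_kerMatrix (hΛ : IsKernelSemilinear (φ := φ) res Λ) (g : GL ι B)
    {X : Matrix ι ι B} (hX : X ∈ kerMatrix φ) :
    (((g⁻¹ : GL ι B) : Matrix ι ι B) * X * (g : Matrix ι ι B)).map Λ =
      conjLin (Matrix.GeneralLinearGroup.map res g)⁻¹ (X.map Λ) := by
  have h := map_conj_of_mem_kerMatrix hΛ g⁻¹ hX
  rw [inv_inv] at h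
  rw [h, map_inv]

omit [Fintype ι] [DecidableEq ι] in
/-- A kernel-semilinear functional preserves the block shape. [folklore] -/
theorem blockTriangular_map_of_kernelSemilinear (hΛ : IsKernelSemilinear (φ := φ) res Λ)
    {α : Type*} [LT α] {b : ι → α} {X : Matrix ι ι B} (hX : X.BlockTriangular b) :
    (X.map Λ).BlockTriangular b := fun i j hij => by
  rw [Matrix.map_apply, hX hij, hΛ.map_zero]

end MapKernel

end LiftingObstruction

namespace NearlyOrdinaryPresentationCA

open LiftingObstruction

/-! ## 1. The data of the cone complex for `R_𝒟` -/

section Data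

variable {F : Type} [Field F] [NumberField F] {p : ℕ} {𝒪 : Type} [CommRing 𝒪] [IsLocalRing 𝒪]
  {k : Type} [Field k] [Algebra 𝒪 k] {𝒟 : NearlyOrdinaryDatum F p 𝒪 k}
  (𝓡 : NearlyOrdinaryDeformationRing.{0} 𝒟)
  {m : ℕ} (Θ : MvPowerSeries (Fin m) 𝒪 →ₐ[𝒪] 𝓡.R) (hΘ : Function.Surjective Θ)
  (n : ℕ) (hn0 : n ≠ 0)

/-- The residue field `κ = 𝒪⟦T⟧/𝔪` carries the DISCRETE topology (scoped instance: the
cone complex needs a topology on the coefficients; `open NearlyOrdinaryPresentationCA` to use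
it). [folklore] -/
scoped instance instTopologicalSpaceResidueField (m : ℕ) (𝒪 : Type) [CommRing 𝒪] [IsLocalRing 𝒪] :
    TopologicalSpace (MvPowerSeries (Fin m) 𝒪 ⧸ maximalIdeal (MvPowerSeries (Fin m) 𝒪)) :=
  ⊥

/-- The scoped topology on `κ` is discrete. [folklore] -/
scoped instance instDiscreteTopologyResidueField (m : ℕ) (𝒪 : Type) [CommRing 𝒪] [IsLocalRing 𝒪] :
    DiscreteTopology (MvPowerSeries (Fin m) 𝒪 ⧸ maximalIdeal (MvPowerSeries (Fin m) 𝒪)) :=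
  ⟨rfl⟩

/-- The places of `F` above `p`. [folklore] -/
abbrev PlacesAbove (F : Type) [Field F] [NumberField F] (p : ℕ) : Type :=
  {v : HeightOneSpectrum (𝓞 F) // (p : 𝓞 F) ∈ v.asIdeal}

omit [IsLocalRing 𝒪] in
/-- There are finitely many places above `p` (they lie in the finite set `S` of a residual
datum). [folklore] -/
theorem finite_placesAbove (𝒟 : NearlyOrdinaryDatum F p 𝒪 k) : Finite (PlacesAbove F p) :=
  (𝒟.S_finite.subset fun v hv => 𝒟.mem_S_of_mem v hv).to_subtype

/-- The decomposition maps `Γ_{F_v} → Γ_F ↠ G_{F,S}`. [folklore] -/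
def coneι (𝒟 : NearlyOrdinaryDatum F p 𝒪 k) (v : PlacesAbove F p) :
    absoluteGaloisGroup (v.1.adicCompletion F) →* GaloisGroupUnramifiedOutside F 𝒟.S :=
  (toUnramifiedQuot F 𝒟.S).comp
    (absGaloisRestrict F (v.1.adicCompletion F) :
      absoluteGaloisGroup (v.1.adicCompletion F) →ₜ* absoluteGaloisGroup F).toMonoidHom

omit [IsLocalRing 𝒪] in
/-- `coneι` on elements. [folklore] -/
@[simp] theorem coneι_apply (𝒟 : NearlyOrdinaryDatum F p 𝒪 k) (v : PlacesAbove F p)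
    (σ : absoluteGaloisGroup (v.1.adicCompletion F)) :
    coneι 𝒟 v σ = toUnramifiedQuot F 𝒟.S (absGaloisRestrict F (v.1.adicCompletion F) σ) :=
  rfl

/-- The reduced nearly ordinary frames with coefficients in `κ`. [folklore] -/
def coneFrame (v : PlacesAbove F p) :
    GL (Fin 2) (MvPowerSeries (Fin m) 𝒪 ⧸ maximalIdeal (MvPowerSeries (Fin m) 𝒪)) :=
  Matrix.GeneralLinearGroup.map (resA Θ hΘ n hn0) (𝓡.noFrameModPow v.1 n)

omit [IsLocalRing 𝒪] in
/-- **The framing relation** `N (localModPow v n σ) N⁻¹ = (ρ_𝒟 mod 𝔪ⁿ)(ι_v σ)` on `G_{F,S}`.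
[folklore] -/
theorem noFrameModPow_conj_localModPow (v : PlacesAbove F p)
    (σ : absoluteGaloisGroup (v.1.adicCompletion F)) :
    𝓡.noFrameModPow v.1 n * 𝓡.localModPow v.1 n σ * (𝓡.noFrameModPow v.1 n)⁻¹ =
      𝓡.modPowQuot n (coneι 𝒟 v σ) := by
  rw [𝓡.localModPow_eq_conj, coneι_apply, NearlyOrdinaryDeformationRing.modPowQuot_mk,
    NearlyOrdinaryDeformationRing.modPow_apply]
  group

/-- The mother extension as a ring homomorphism. [folklore] -/
abbrev q0Hom : (MvPowerSeries (Fin m) 𝒪 ⧸ motherIdeal Θ n) →+* 𝓡.R ⧸ maximalIdeal 𝓡.R ^ n :=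
  (q0Raw Θ hΘ n : (MvPowerSeries (Fin m) 𝒪 ⧸ motherIdeal Θ n) →ₐ[𝒪] 𝓡.R ⧸ maximalIdeal 𝓡.R ^ n)

/-- `q₀` is onto (as a ring homomorphism). [folklore] -/
theorem q0Hom_surjective : Function.Surjective (q0Hom 𝓡 Θ hΘ n) :=
  q0Raw_surjective Θ hΘ n

include hn0 in
/-- `ker q₀` has square zero (as a ring homomorphism). [folklore] -/
theorem q0Hom_sqZero : ∀ x ∈ RingHom.ker (q0Hom 𝓡 Θ hΘ n), ∀ y ∈ RingHom.ker (q0Hom 𝓡 Θ hΘ n),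
    x * y = 0 := fun x hx y hy =>
  q0Raw_sqZero Θ hΘ n hn0 x y ((RingHom.mem_ker).mp hx) ((RingHom.mem_ker).mp hy)

/-- **The standard section `s₀` of the mother extension.** [cite: Mazur1989Deforming, §1.6 Prop. 2] -/
def s0 : GL (Fin 2) (𝓡.R ⧸ maximalIdeal 𝓡.R ^ n) → GL (Fin 2) (MvPowerSeries (Fin m) 𝒪 ⧸ motherIdeal Θ n) :=
  stdSection (q0Hom_surjective 𝓡 Θ hΘ n) (q0Hom_sqZero 𝓡 Θ hΘ n hn0)

/-- `s₀` is a section. [folklore] -/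
@[simp] theorem map_s0 (g : GL (Fin 2) (𝓡.R ⧸ maximalIdeal 𝓡.R ^ n)) :
    Matrix.GeneralLinearGroup.map (q0Hom 𝓡 Θ hΘ n) (s0 𝓡 Θ hΘ n hn0 g) = g :=
  map_stdSection _ _ g

/-- `s₀` is compatible with every block pattern. [folklore] -/
theorem s0_mem_parabolicGL {α : Type*} [LinearOrder α] (b : Fin 2 → α)
    (g : GL (Fin 2) (𝓡.R ⧸ maximalIdeal 𝓡.R ^ n)) (hg : g ∈ parabolicGL b (𝓡.R ⧸ maximalIdeal 𝓡.R ^ n)) :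
    s0 𝓡 Θ hΘ n hn0 g ∈ parabolicGL b (MvPowerSeries (Fin m) 𝒪 ⧸ motherIdeal Θ n) :=
  stdSection_mem_parabolicGL b _ _ hg

/-- **The residue map of `B₀` factors through `q₀`**: `res₀ = resA ∘ q₀`. [folklore] -/
theorem motherResidue_eq_resA_comp :
    motherResidue Θ n hn0 = (resA Θ hΘ n hn0).comp (q0Hom 𝓡 Θ hΘ n) := by
  refine Ideal.Quotient.ringHom_ext (RingHom.ext fun x => ?_)
  rw [RingHom.comp_apply, RingHom.comp_apply, motherResidue_mk, RingHom.comp_apply]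
  change _ = resA Θ hΘ n hn0 (q0Raw Θ hΘ n (Ideal.Quotient.mk (motherIdeal Θ n) x))
  rw [q0Raw_mk, resA_mk_apply]

/-- `GL₂(res₀)(s₀ g) = GL₂(resA)(g)`: the section reduces to the residual representation.
[folklore] -/
theorem map_motherResidue_s0 (g : GL (Fin 2) (𝓡.R ⧸ maximalIdeal 𝓡.R ^ n)) :
    Matrix.GeneralLinearGroup.map (motherResidue Θ n hn0) (s0 𝓡 Θ hΘ n hn0 g) =
      Matrix.GeneralLinearGroup.map (resA Θ hΘ n hn0) g := by
  rw [motherResidue_eq_resA_comp 𝓡 Θ hΘ n hn0, Matrix.GeneralLinearGroup.map_comp,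
    MonoidHom.comp_apply, map_s0]

/-- The framed section at `v`: `s₀''(g) = P₀⁻¹ s₀(N g N⁻¹) P₀`, `P₀ = s₀(N)`. [folklore] -/
def s0Framed (v : PlacesAbove F p) :
    GL (Fin 2) (𝓡.R ⧸ maximalIdeal 𝓡.R ^ n) → GL (Fin 2) (MvPowerSeries (Fin m) 𝒪 ⧸ motherIdeal Θ n) :=
  frameSection (s0 𝓡 Θ hΘ n hn0) (𝓡.noFrameModPow v.1 n) (s0 𝓡 Θ hΘ n hn0 (𝓡.noFrameModPow v.1 n))

/-- `s₀''` is a section. [folklore] -/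
theorem map_s0Framed (v : PlacesAbove F p) (g : GL (Fin 2) (𝓡.R ⧸ maximalIdeal 𝓡.R ^ n)) :
    Matrix.GeneralLinearGroup.map (q0Hom 𝓡 Θ hΘ n) (s0Framed 𝓡 Θ hΘ n hn0 v g) = g :=
  map_frameSection (map_s0 𝓡 Θ hΘ n hn0) _ _ (map_s0 𝓡 Θ hΘ n hn0 _) g

end Data

/-! ## 2. The cone cochain of a functional -/

section Cochain

variable {F : Type} [Field F] [NumberField F] {p : ℕ} {𝒪 : Type} [CommRing 𝒪] [IsLocalRing 𝒪]
  {k : Type} [Field k] [Algebra 𝒪 k] {𝒟 : NearlyOrdinaryDatum F p 𝒪 k}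
  (𝓡 : NearlyOrdinaryDeformationRing.{0} 𝒟)
  {m : ℕ} (Θ : MvPowerSeries (Fin m) 𝒪 →ₐ[𝒪] 𝓡.R) (hΘ : Function.Surjective Θ)
  (n : ℕ) (hn0 : n ≠ 0)
  (u : Module.Dual (MvPowerSeries (Fin m) 𝒪 ⧸ maximalIdeal (MvPowerSeries (Fin m) 𝒪))
    (↥(RingHom.ker Θ) ⧸ (maximalIdeal (MvPowerSeries (Fin m) 𝒪) •
      (⊤ : Submodule (MvPowerSeries (Fin m) 𝒪) ↥(RingHom.ker Θ)))))

/-- **The cone cochain of `u`**: `(Λ_u ∘ c_{s₀}(ρ mod 𝔪ⁿ), (Λ_u ∘ c_{s₀}(localModPow v n))_v,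
(Λ_u ∘ β_v)_v)`. [cite: Bockle2007Presentations, Theorem 7.6] -/
def coneCochainOf : ConeCochains (Fin 2) (MvPowerSeries (Fin m) 𝒪 ⧸ maximalIdeal (MvPowerSeries (Fin m) 𝒪))
    (GaloisGroupUnramifiedOutside F 𝒟.S) (fun v : PlacesAbove F p => absoluteGaloisGroup (v.1.adicCompletion F)) :=
  (fun στ => (liftDefect (s0 𝓡 Θ hΘ n hn0) (𝓡.modPowQuot n) στ.1 στ.2).map (coeffFun Θ n u),
    fun v => (fun στ => (liftDefect (s0 𝓡 Θ hΘ n hn0) (𝓡.localModPow v.1 n) στ.1 στ.2).map (coeffFun Θ n u),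
      fun σ => (sectionDiff (s0 𝓡 Θ hΘ n hn0) (s0Framed 𝓡 Θ hΘ n hn0 v) (𝓡.localModPow v.1 n) σ).map
        (coeffFun Θ n u)))

/-- The global component of the cone cochain. [folklore] -/
@[simp] theorem coneCochainOf_fst (σ τ : GaloisGroupUnramifiedOutside F 𝒟.S) :
    (coneCochainOf 𝓡 Θ hΘ n hn0 u).1 (σ, τ) =
      (liftDefect (s0 𝓡 Θ hΘ n hn0) (𝓡.modPowQuot n) σ τ).map (coeffFun Θ n u) :=
  rfl

/-- The local `2`-cochain component of the cone cochain. [folklore] -/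
@[simp] theorem coneCochainOf_snd_fst (v : PlacesAbove F p)
    (σ τ : absoluteGaloisGroup (v.1.adicCompletion F)) :
    ((coneCochainOf 𝓡 Θ hΘ n hn0 u).2 v).1 (σ, τ) =
      (liftDefect (s0 𝓡 Θ hΘ n hn0) (𝓡.localModPow v.1 n) σ τ).map (coeffFun Θ n u) :=
  rfl

/-- The local `1`-cochain component of the cone cochain. [folklore] -/
@[simp] theorem coneCochainOf_snd_snd (v : PlacesAbove F p)
    (σ : absoluteGaloisGroup (v.1.adicCompletion F)) :
    ((coneCochainOf 𝓡 Θ hΘ n hn0 u).2 v).2 σ =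
      (sectionDiff (s0 𝓡 Θ hΘ n hn0) (s0Framed 𝓡 Θ hΘ n hn0 v) (𝓡.localModPow v.1 n) σ).map
        (coeffFun Θ n u) :=
  rfl

/-- **Additivity in `u`.** [cite: Mazur1989Deforming, §1.6 Prop. 2] -/
theorem coneCochainOf_add
    (u' : Module.Dual (MvPowerSeries (Fin m) 𝒪 ⧸ maximalIdeal (MvPowerSeries (Fin m) 𝒪))
      (↥(RingHom.ker Θ) ⧸ (maximalIdeal (MvPowerSeries (Fin m) 𝒪) •
        (⊤ : Submodule (MvPowerSeries (Fin m) 𝒪) ↥(RingHom.ker Θ))))) :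
    coneCochainOf 𝓡 Θ hΘ n hn0 (u + u') = coneCochainOf 𝓡 Θ hΘ n hn0 u + coneCochainOf 𝓡 Θ hΘ n hn0 u' := by
  refine Prod.ext (funext fun στ => ?_) (funext fun v => Prod.ext (funext fun στ => ?_) (funext fun σ => ?_))
  all_goals
    ext i j
    simp only [coneCochainOf, Prod.fst_add, Prod.snd_add, Pi.add_apply, Matrix.map_apply,
      Matrix.add_apply, coeffFun_add]

/-- **Homogeneity in `u`.** [folklore] -/
theorem coneCochainOf_smul (c : MvPowerSeries (Fin m) 𝒪 ⧸ maximalIdeal (MvPowerSeries (Fin m) 𝒪)) :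
    coneCochainOf 𝓡 Θ hΘ n hn0 (c • u) = c • coneCochainOf 𝓡 Θ hΘ n hn0 u := by
  refine Prod.ext (funext fun στ => ?_) (funext fun v => Prod.ext (funext fun στ => ?_) (funext fun σ => ?_))
  all_goals
    ext i j
    simp only [coneCochainOf, Prod.smul_fst, Prod.smul_snd, Pi.smul_apply, Matrix.map_apply,
      Matrix.smul_apply, smul_eq_mul, coeffFun_smul]

/-! ## 3. The cone cochain of `u` is a cone cocycle -/

variable (hJn : RingHom.ker Θ ⊓ maximalIdeal (MvPowerSeries (Fin m) 𝒪) ^ n ≤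
    maximalIdeal (MvPowerSeries (Fin m) 𝒪) * RingHom.ker Θ)

include hJn in
/-- The coefficient functional is kernel-semilinear for `q₀` (restated with `q0Hom`). [folklore] -/
theorem isKernelSemilinear_coeffFun' :
    IsKernelSemilinear (φ := q0Hom 𝓡 Θ hΘ n) (motherResidue Θ n hn0) (coeffFun Θ n u) :=
  isKernelSemilinear_coeffFun Θ hΘ n u hJn hn0

/-- `GL₂(res₀) ∘ s₀ ∘ (ρ mod 𝔪ⁿ) = residualK` on `G_{F,S}`. [folklore] -/
theorem map_motherResidue_s0_modPowQuot (σ : GaloisGroupUnramifiedOutside F 𝒟.S) :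
    Matrix.GeneralLinearGroup.map (motherResidue Θ n hn0) (s0 𝓡 Θ hΘ n hn0 (𝓡.modPowQuot n σ)) =
      residualK 𝓡 Θ hΘ n hn0 σ := by
  rw [map_motherResidue_s0, residualK_apply]

/-- `GL₂(res₀) ∘ s₀ ∘ localModPow v n = localResidualK v`. [folklore] -/
theorem map_motherResidue_s0_localModPow (v : PlacesAbove F p)
    (σ : absoluteGaloisGroup (v.1.adicCompletion F)) :
    Matrix.GeneralLinearGroup.map (motherResidue Θ n hn0) (s0 𝓡 Θ hΘ n hn0 (𝓡.localModPow v.1 n σ)) =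
      localResidualK 𝓡 Θ hΘ n hn0 v.1 σ := by
  rw [map_motherResidue_s0, localResidualK_apply]

/-- `GL₂(res₀)(P₀) = coneFrame v` for `P₀ = s₀(N)`. [folklore] -/
theorem map_motherResidue_s0_noFrameModPow (v : PlacesAbove F p) :
    Matrix.GeneralLinearGroup.map (motherResidue Θ n hn0) (s0 𝓡 Θ hΘ n hn0 (𝓡.noFrameModPow v.1 n)) =
      coneFrame 𝓡 Θ hΘ n hn0 v := by
  rw [map_motherResidue_s0, coneFrame]

include hJn in
/-- **The image under `Λ_u` of a defect cocycle is a `2`-cocycle** for the conjugation action of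
the residual representation. [cite: Mazur1989Deforming, §1.6 Prop. 2] -/
theorem isTwoCocycleFn_map_liftDefect {G : Type*} [Group G]
    (ρ : G →* GL (Fin 2) (𝓡.R ⧸ maximalIdeal 𝓡.R ^ n))
    (r : G →* GL (Fin 2) (MvPowerSeries (Fin m) 𝒪 ⧸ maximalIdeal (MvPowerSeries (Fin m) 𝒪)))
    (hr : ∀ σ, Matrix.GeneralLinearGroup.map (motherResidue Θ n hn0) (s0 𝓡 Θ hΘ n hn0 (ρ σ)) = r σ) :
    IsTwoCocycleFn r fun στ => (liftDefect (s0 𝓡 Θ hΘ n hn0) ρ στ.1 στ.2).map (coeffFun Θ n u) := by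
  have hΛ := isKernelSemilinear_coeffFun' 𝓡 Θ hΘ n hn0 u hJn
  have hs := map_s0 𝓡 Θ hΘ n hn0
  have hmem : ∀ σ τ, liftDefect (s0 𝓡 Θ hΘ n hn0) ρ σ τ ∈ kerMatrix (q0Hom 𝓡 Θ hΘ n) :=
    liftDefect_mem hs ρ
  intro σ τ υ
  have hc := liftDefect_cocycle hs (q0Hom_sqZero 𝓡 Θ hΘ n hn0) ρ σ τ υ
  have hconj : (s0 𝓡 Θ hΘ n hn0 (ρ σ) : Matrix (Fin 2) (Fin 2) _) * liftDefect (s0 𝓡 Θ hΘ n hn0) ρ τ υ *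
      (((s0 𝓡 Θ hΘ n hn0 (ρ σ))⁻¹ : GL (Fin 2) _) : Matrix (Fin 2) (Fin 2) _) ∈
        kerMatrix (q0Hom 𝓡 Θ hΘ n) :=
    mul_mem_kerMatrix_right _ (mul_mem_kerMatrix_left _ (hmem τ υ))
  have h := congrArg (fun M : Matrix (Fin 2) (Fin 2) _ => M.map (coeffFun Θ n u)) hc
  rw [map_add_of_mem_kerMatrix hΛ hconj (hmem _ _), map_add_of_mem_kerMatrix hΛ (hmem _ _) (hmem _ _),
    map_conj_of_mem_kerMatrix hΛ _ (hmem τ υ), hr] at h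
  exact h

include hJn in
/-- **The cone cochain of `u` is a cone cocycle.** [cite: Bockle2007Presentations, Theorem 7.6] -/
theorem coneCochainOf_mem :
    coneCochainOf 𝓡 Θ hΘ n hn0 u ∈
      coneCocycles (residualK 𝓡 Θ hΘ n hn0)
        (fun v : PlacesAbove F p => absoluteGaloisGroup (v.1.adicCompletion F)) (coneι 𝒟)
        (fun v : PlacesAbove F p => localResidualK 𝓡 Θ hΘ n hn0 v.1) (id : Fin 2 → Fin 2)
        (coneFrame 𝓡 Θ hΘ n hn0) := by
  have hΛ := isKernelSemilinear_coeffFun' 𝓡 Θ hΘ n hn0 u hJn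
  have hs := map_s0 𝓡 Θ hΘ n hn0
  have hI := q0Hom_sqZero 𝓡 Θ hΘ n hn0
  refine ⟨?_, ?_, fun v => ⟨?_, ?_, ?_, ?_, ?_⟩⟩
  · -- continuity of the global component
    exact ((isLocallyConstant_liftDefect (s := s0 𝓡 Θ hΘ n hn0) (𝓡.modPowQuot n)
      (𝓡.isOpen_ker_modPowQuot n)).comp fun M => M.map (coeffFun Θ n u)).continuous
  · exact isTwoCocycleFn_map_liftDefect 𝓡 Θ hΘ n hn0 u hJn _ _
      (map_motherResidue_s0_modPowQuot 𝓡 Θ hΘ n hn0)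
  · exact ((isLocallyConstant_liftDefect (s := s0 𝓡 Θ hΘ n hn0) (𝓡.localModPow v.1 n)
      (𝓡.isOpen_ker_localModPow v.1 n)).comp fun M => M.map (coeffFun Θ n u)).continuous
  · -- continuity of the local `1`-cochain: it factors through `localModPow v n`
    have hlc : IsLocallyConstant fun σ : absoluteGaloisGroup (v.1.adicCompletion F) =>
        sectionDiff (s0 𝓡 Θ hΘ n hn0) (s0Framed 𝓡 Θ hΘ n hn0 v) (𝓡.localModPow v.1 n) σ := by
      have h := (isLocallyConstant_of_isOpen_ker' _ (𝓡.isOpen_ker_localModPow v.1 n)).comp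
        fun g : GL (Fin 2) (𝓡.R ⧸ maximalIdeal 𝓡.R ^ n) =>
          ((s0Framed 𝓡 Θ hΘ n hn0 v g * (s0 𝓡 Θ hΘ n hn0 g)⁻¹ :
              GL (Fin 2) (MvPowerSeries (Fin m) 𝒪 ⧸ motherIdeal Θ n)) :
            Matrix (Fin 2) (Fin 2) (MvPowerSeries (Fin m) 𝒪 ⧸ motherIdeal Θ n)) - 1
      exact h
    exact (hlc.comp fun M => M.map (coeffFun Θ n u)).continuous
  · -- the local `2`-cochain is upper triangular
    intro στ
    exact blockTriangular_map_of_kernelSemilinear hΛ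
      (liftDefect_mem_kerParabolic (id : Fin 2 → Fin 2) hs
        (fun g hg => s0_mem_parabolicGL 𝓡 Θ hΘ n hn0 id g hg) (𝓡.localModPow v.1 n)
        (fun σ => 𝓡.localModPow_mem_borel v.1 v.2 n σ) στ.1 στ.2).2
  · exact isTwoCocycleFn_map_liftDefect 𝓡 Θ hΘ n hn0 u hJn _ _
      (map_motherResidue_s0_localModPow 𝓡 Θ hΘ n hn0 v)
  · -- the linking identity
    intro σ τ
    set s := s0 𝓡 Θ hΘ n hn0 with hsdef
    set s'' := s0Framed 𝓡 Θ hΘ n hn0 v with hs''def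
    set ρ' := 𝓡.localModPow v.1 n with hρ'def
    set N := 𝓡.noFrameModPow v.1 n with hNdef
    have hs'' : ∀ g, Matrix.GeneralLinearGroup.map (q0Hom 𝓡 Θ hΘ n) (s'' g) = g :=
      map_s0Framed 𝓡 Θ hΘ n hn0 v
    -- (a) independence of the section
    have e1 := liftDefect_sub_liftDefect hI hs hs'' ρ' σ τ
    -- (b) change of frame
    have e2 : liftDefect s'' ρ' σ τ = (((s N)⁻¹ : GL (Fin 2) _) : Matrix (Fin 2) (Fin 2) _) *
        liftDefect s (𝓡.modPowQuot n) (coneι 𝒟 v σ) (coneι 𝒟 v τ) * (s N : Matrix (Fin 2) (Fin 2) _) :=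
      liftDefect_frameSection (𝓡.modPowQuot n) (coneι 𝒟 v) N ρ'
        (noFrameModPow_conj_localModPow 𝓡 n v) s (s N) σ τ
    rw [e2] at e1
    -- kernel memberships
    have hβ : ∀ σ, sectionDiff s s'' ρ' σ ∈ kerMatrix (q0Hom 𝓡 Θ hΘ n) := sectionDiff_mem hs hs'' ρ'
    have hc : ∀ σ τ, liftDefect s (𝓡.modPowQuot n) σ τ ∈ kerMatrix (q0Hom 𝓡 Θ hΘ n) :=
      liftDefect_mem hs _
    have hcv : ∀ σ τ, liftDefect s ρ' σ τ ∈ kerMatrix (q0Hom 𝓡 Θ hΘ n) := liftDefect_mem hs _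
    have hconjc : (((s N)⁻¹ : GL (Fin 2) _) : Matrix (Fin 2) (Fin 2) _) *
        liftDefect s (𝓡.modPowQuot n) (coneι 𝒟 v σ) (coneι 𝒟 v τ) * (s N : Matrix (Fin 2) (Fin 2) _) ∈
          kerMatrix (q0Hom 𝓡 Θ hΘ n) :=
      mul_mem_kerMatrix_right _ (mul_mem_kerMatrix_left _ (hc _ _))
    have hconjβ : (s (ρ' σ) : Matrix (Fin 2) (Fin 2) _) * sectionDiff s s'' ρ' τ *
        (((s (ρ' σ))⁻¹ : GL (Fin 2) _) : Matrix (Fin 2) (Fin 2) _) ∈ kerMatrix (q0Hom 𝓡 Θ hΘ n) :=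
      mul_mem_kerMatrix_right _ (mul_mem_kerMatrix_left _ (hβ τ))
    -- apply `Λ_u` entrywise to (a) = (b)
    have h := congrArg (fun M : Matrix (Fin 2) (Fin 2) _ => M.map (coeffFun Θ n u)) e1
    rw [map_sub_of_mem_kerMatrix hΛ hconjc (hcv _ _),
      map_add_of_mem_kerMatrix hΛ ((kerMatrix _).sub_mem hconjβ (hβ _)) (hβ _),
      map_sub_of_mem_kerMatrix hΛ hconjβ (hβ _),
      map_conj_of_mem_kerMatrix hΛ _ (hβ τ), map_conj_inv_of_mem_kerMatrix hΛ _ (hc _ _),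
      map_motherResidue_s0_localModPow, map_motherResidue_s0_noFrameModPow] at h
    simp only [coneCochainOf]
    exact h.symm

/-- The cone cochain of `u` as a cone cocycle. [cite: Bockle2007Presentations, Theorem 7.6] -/
def coneCocycleOf :
    coneCocycles (residualK 𝓡 Θ hΘ n hn0)
      (fun v : PlacesAbove F p => absoluteGaloisGroup (v.1.adicCompletion F)) (coneι 𝒟)
      (fun v : PlacesAbove F p => localResidualK 𝓡 Θ hΘ n hn0 v.1) (id : Fin 2 → Fin 2)
      (coneFrame 𝓡 Θ hΘ n hn0) :=
  ⟨coneCochainOf 𝓡 Θ hΘ n hn0 u, coneCochainOf_mem 𝓡 Θ hΘ n hn0 u hJn⟩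

/-! ## 4. The cone obstruction map -/

/-- The cone cocycle of `u` depends LINEARLY on `u`. [cite: Mazur1989Deforming, §1.6 Prop. 2] -/
def coneCocycleOfₗ :
    Module.Dual (MvPowerSeries (Fin m) 𝒪 ⧸ maximalIdeal (MvPowerSeries (Fin m) 𝒪))
        (↥(RingHom.ker Θ) ⧸ (maximalIdeal (MvPowerSeries (Fin m) 𝒪) •
          (⊤ : Submodule (MvPowerSeries (Fin m) 𝒪) ↥(RingHom.ker Θ)))) →ₗ[
      MvPowerSeries (Fin m) 𝒪 ⧸ maximalIdeal (MvPowerSeries (Fin m) 𝒪)]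
      ↥(coneCocycles (residualK 𝓡 Θ hΘ n hn0)
        (fun v : PlacesAbove F p => absoluteGaloisGroup (v.1.adicCompletion F)) (coneι 𝒟)
        (fun v : PlacesAbove F p => localResidualK 𝓡 Θ hΘ n hn0 v.1) (id : Fin 2 → Fin 2)
        (coneFrame 𝓡 Θ hΘ n hn0)) where
  toFun u := coneCocycleOf 𝓡 Θ hΘ n hn0 u hJn
  map_add' u u' := Subtype.ext (coneCochainOf_add 𝓡 Θ hΘ n hn0 u u')
  map_smul' c u := Subtype.ext (coneCochainOf_smul 𝓡 Θ hΘ n hn0 u c)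

/-- **The cone obstruction map** `u ↦ [cone cochain of u]`, a `κ`-linear map
`(J/𝔪J)^* → ConeH2`. [cite: Bockle2007Presentations, Theorem 7.6] -/
def coneOb :
    Module.Dual (MvPowerSeries (Fin m) 𝒪 ⧸ maximalIdeal (MvPowerSeries (Fin m) 𝒪))
        (↥(RingHom.ker Θ) ⧸ (maximalIdeal (MvPowerSeries (Fin m) 𝒪) •
          (⊤ : Submodule (MvPowerSeries (Fin m) 𝒪) ↥(RingHom.ker Θ)))) →ₗ[
      MvPowerSeries (Fin m) 𝒪 ⧸ maximalIdeal (MvPowerSeries (Fin m) 𝒪)]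
      ConeH2 (residualK 𝓡 Θ hΘ n hn0)
        (fun v : PlacesAbove F p => absoluteGaloisGroup (v.1.adicCompletion F)) (coneι 𝒟)
        (fun v : PlacesAbove F p => localResidualK 𝓡 Θ hΘ n hn0 v.1) (id : Fin 2 → Fin 2)
        (coneFrame 𝓡 Θ hΘ n hn0) :=
  (coneClassₗ _ _ _ _ _ _).comp (coneCocycleOfₗ 𝓡 Θ hΘ n hn0 hJn)

/-- `coneOb u` is the class of the cone cochain of `u`. [folklore] -/
theorem coneOb_apply
    (u : Module.Dual (MvPowerSeries (Fin m) 𝒪 ⧸ maximalIdeal (MvPowerSeries (Fin m) 𝒪))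
      (↥(RingHom.ker Θ) ⧸ (maximalIdeal (MvPowerSeries (Fin m) 𝒪) •
        (⊤ : Submodule (MvPowerSeries (Fin m) 𝒪) ↥(RingHom.ker Θ))))) :
    coneOb 𝓡 Θ hΘ n hn0 hJn u = coneClass _ _ _ _ _ _ (coneCocycleOf 𝓡 Θ hΘ n hn0 u hJn) :=
  rfl

/-- **Vanishing of `coneOb u`** means: the cone cochain of `u` is a cone coboundary.
[cite: Bockle2007Presentations, Theorem 7.6] -/
theorem coneOb_eq_zero_iff
    (u : Module.Dual (MvPowerSeries (Fin m) 𝒪 ⧸ maximalIdeal (MvPowerSeries (Fin m) 𝒪))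
      (↥(RingHom.ker Θ) ⧸ (maximalIdeal (MvPowerSeries (Fin m) 𝒪) •
        (⊤ : Submodule (MvPowerSeries (Fin m) 𝒪) ↥(RingHom.ker Θ))))) :
    coneOb 𝓡 Θ hΘ n hn0 hJn u = 0 ↔
      IsConeCoboundary (residualK 𝓡 Θ hΘ n hn0)
        (fun v : PlacesAbove F p => absoluteGaloisGroup (v.1.adicCompletion F)) (coneι 𝒟)
        (fun v : PlacesAbove F p => localResidualK 𝓡 Θ hΘ n hn0 v.1) (id : Fin 2 → Fin 2)
        (coneFrame 𝓡 Θ hΘ n hn0) (coneCochainOf 𝓡 Θ hΘ n hn0 u) := by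
  rw [coneOb_apply, coneClass_eq_zero_iff]
  rfl

end Cochain

end NearlyOrdinaryPresentationCA

end Literature.NumberTheory.GaloisRepresentations
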